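import Mathlib
import Summits.Ventures.PercRepro2.TypedSeparatedSides
import Summits.Ventures.PercRepro2.OneEdge
import Summits.Ventures.PercRepro2.RootBridgeStates

/-!
# The root-bridge class of row 2′TRI, II: the states of the support and the kernel identity
(blind cell PercRepro2, p3 g0, 2026-08-25; `proofs/P3-BRIDGE.md` §2, sub-claim S2.b)

A ROOT-BRIDGE instance `(F, z, τ)`: a typed edge `f ∈ F` with `ends f = s(a₁, v)` such that the
roots are separated once `f` is closed (`Sep ends a₁ a₂ (F.erase f) z`, `z f = false`), with
`o, b` on `a₁`'s side and `v, a₃` on `a₂`'s side of `z ∪ (F ∖ f)`.  On the support every copy has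
the bridge state `brSt` of `RootBridgeStates.lean` (`st_eq_brSt`, by `OneEdge.conn_update_true_iff`
— with the bridge open, `C(a₁) = C_L(a₁) ∪ C_H(v)` and `C(a₂) = C_H(a₂) ∪ 1[v ∈ C_H(a₂)]·C_L(a₁)`),
its `h`-state (`hst`, the set partition of `{a₂, v, a₃}` with the bridge closed) is that of its
`h⁺`-restriction (`hst_restr`, domain Markov), and `K₃` is the four-monomial expansion
`KB_brSt`, each monomial an `l`-kernel of the `l`-restriction times an `h⁺`-kernel of the
`h⁺`-restriction (`K3_eq_bridge`).  Part III (`RootBridge.lean`) counts.  Own work; standard axioms.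
-/

namespace Summit.Ventures.PercRepro2

open UnionCluster

namespace CovForm

namespace RootBridge

open OneTyped TypedA3 Untouched TypedFactor Separated OneEdge

/-! ## The `h`-state of a configuration -/

section HStateOf

open Classical

variable {V : Type*} {E : Type*} [DecidableEq E]
variable (ends : E → Sym2 V) (a₂ a₃ v : V) (f : E)

/-- The set partition of `{a₂, v, a₃}` induced by a configuration with the bridge closed. -/
noncomputable def hst (y : Config E) : HState :=
  if Conn ends (Function.update y f false) a₂ v then
    (if Conn ends (Function.update y f false) a₂ a₃ then HState.A else HState.C)
  else if Conn ends (Function.update y f false) a₂ a₃ then HState.B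
  else if Conn ends (Function.update y f false) v a₃ then HState.D else HState.E

/-- `hv` of the `h`-state is `a₂ ↔ v` with the bridge closed. -/
lemma hst_hv (y : Config E) :
    (hst ends a₂ a₃ v f y).hv = decide (Conn ends (Function.update y f false) a₂ v) := by
  unfold hst
  by_cases h1 : Conn ends (Function.update y f false) a₂ v <;>
    by_cases h2 : Conn ends (Function.update y f false) a₂ a₃ <;>
    by_cases h3 : Conn ends (Function.update y f false) v a₃ <;> simp [h1, h2, h3, HState.hv]

/-- `h3` of the `h`-state is `a₂ ↔ a₃` with the bridge closed. -/
lemma hst_h3 (y : Config E) :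
    (hst ends a₂ a₃ v f y).h3 = decide (Conn ends (Function.update y f false) a₂ a₃) := by
  unfold hst
  by_cases h1 : Conn ends (Function.update y f false) a₂ v <;>
    by_cases h2 : Conn ends (Function.update y f false) a₂ a₃ <;>
    by_cases h3 : Conn ends (Function.update y f false) v a₃ <;> simp [h1, h2, h3, HState.h3]

/-- `v3` of the `h`-state is `v ↔ a₃` with the bridge closed (transitivity of connection). -/
lemma hst_v3 (y : Config E) :
    (hst ends a₂ a₃ v f y).v3 = decide (Conn ends (Function.update y f false) v a₃) := by
  unfold hst
  by_cases h1 : Conn ends (Function.update y f false) a₂ v <;>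
    by_cases h2 : Conn ends (Function.update y f false) a₂ a₃ <;>
    by_cases h3 : Conn ends (Function.update y f false) v a₃ <;> simp [h1, h2, h3, HState.v3]
  · exact h3 (conn_trans (conn_symm h1) h2)
  · exact h2 (conn_trans h1 h3)
  · exact h1 (conn_trans h2 (conn_symm h3))

end HStateOf

/-! ## The support of a root-bridge instance -/

section Support

open Classical

variable {V : Type*} {E : Type*} [Fintype E] [DecidableEq E]
variable (ends : E → Sym2 V) (o a₁ a₂ a₃ b v : V) (f : E)

omit [Fintype E] in
/-- A copy of the support of `(F, z)` with the bridge closed is on the support of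
`(F ∖ f, z[f ↦ closed])`. -/
lemma closed_on_support {F : Finset E} {z x : Config E} (hx : ∀ e, e ∉ F → x e = z e) (hf : f ∈ F) :
    ∀ e, e ∉ F.erase f → Function.update x f false e = Function.update z f false e := by
  intro e he
  by_cases hef : e = f
  · subst hef; simp
  · rw [Function.update_of_ne hef, Function.update_of_ne hef]
    exact hx e fun h => he (Finset.mem_erase.2 ⟨hef, h⟩)

omit [Fintype E] in
/-- A configuration is its bridge-closed version with the bridge re-set. -/
lemma eq_update_closed (x : Config E) :
    x = Function.update (Function.update x f false) f (x f) := by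
  rw [Function.update_idem, Function.update_eq_self]

omit [Fintype E] in
/-- **The state of a copy of the support of a root-bridge instance** (`o, b` on `a₁`'s side,
`v, a₃` on `a₂`'s side): the bridge state of its bit at `f`, its `h`-state and its `l`-data. -/
theorem st_eq_brSt {F : Finset E} {z : Config E} (hzf : z f = false) (hf : f ∈ F)
    (hends : ends f = s(a₁, v)) (hsep : Sep ends a₁ a₂ (F.erase f) z)
    (hv : v ∈ cluster ends (zF (F.erase f) z) a₂) (ho : o ∈ cluster ends (zF (F.erase f) z) a₁)
    (hb : b ∈ cluster ends (zF (F.erase f) z) a₁) (h3 : a₃ ∈ cluster ends (zF (F.erase f) z) a₂)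
    {x : Config E} (hx : ∀ e, e ∉ F → x e = z e) :
    st ends o a₁ a₂ a₃ b x =
      brSt (x f) (hst ends a₂ a₃ v f x) (decide (Conn ends (Function.update x f false) a₁ o))
        (decide (Conn ends (Function.update x f false) a₁ b)) := by
  set xf := Function.update x f false with hxf
  have hzz : Function.update z f false = z := Function.update_eq_self_iff.2 hzf.symm
  have hxf' : ∀ e, e ∉ F.erase f → xf e = z e := by
    have := closed_on_support f hx hf
    rwa [hzz] at this
  have hle : xf ≤ zF (F.erase f) z := le_zF hxf'
  rw [mem_cluster] at hv ho hb h3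
  -- the bridge-closed connections that are impossible
  have hq : ¬ Conn ends xf a₂ a₁ := fun h => hsep (conn_mono hle h)
  have hL3 : ¬ Conn ends xf a₁ a₃ := fun h => hsep (conn_trans h3 (conn_symm (conn_mono hle h)))
  have hHo : ¬ Conn ends xf a₂ o := fun h => hsep (conn_trans (conn_mono hle h) (conn_symm ho))
  have hHb : ¬ Conn ends xf a₂ b := fun h => hsep (conn_trans (conn_mono hle h) (conn_symm hb))
  have ha1v : ¬ Conn ends xf a₁ v := fun h => hsep (conn_trans hv (conn_symm (conn_mono hle h)))
  have hvo : ¬ Conn ends xf v o := fun h =>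
    hsep (conn_trans hv (conn_trans (conn_mono hle h) (conn_symm ho)))
  have hvb : ¬ Conn ends xf v b := fun h =>
    hsep (conn_trans hv (conn_trans (conn_mono hle h) (conn_symm hb)))
  have hhv := hst_hv ends a₂ a₃ v f x
  have hh3 := hst_h3 ends a₂ a₃ v f x
  have hv3 := hst_v3 ends a₂ a₃ v f x
  rw [← hxf] at hhv hh3 hv3
  unfold st brSt
  rw [hhv, hh3, hv3]
  cases hxfb : x f
  · -- bridge closed: `x = xf`
    have hxx : x = xf := by rw [hxf, ← hxfb, Function.update_eq_self]
    rw [hxx]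
    simp only [Bool.false_and, hq, hL3, hHo, hHb, decide_false]
  · -- bridge open: `x = xf[f ↦ open]`, `OneEdge.conn_update_true_iff`
    have hxx : x = Function.update xf f true := by rw [hxf, Function.update_idem, ← hxfb, Function.update_eq_self]
    have key := fun s t => conn_update_true_iff hends xf s t
    rw [hxx]
    simp only [Bool.true_and]
    have e1 : Conn ends (Function.update xf f true) a₂ a₁ ↔ Conn ends xf a₂ v := by
      rw [key]; constructor
      · rintro (h | ⟨h, _⟩ | ⟨h, _⟩)
        · exact absurd h hq
        · exact absurd h hq
        · exact h
      · intro h; exact Or.inr (Or.inr ⟨h, conn_refl _ _ _⟩)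
    have e2 : Conn ends (Function.update xf f true) a₁ o ↔ Conn ends xf a₁ o := by
      rw [key]; constructor
      · rintro (h | ⟨_, h⟩ | ⟨h, _⟩)
        · exact h
        · exact absurd h hvo
        · exact absurd h ha1v
      · intro h; exact Or.inl h
    have e3 : Conn ends (Function.update xf f true) a₂ o ↔ Conn ends xf a₂ v ∧ Conn ends xf a₁ o := by
      rw [key]; constructor
      · rintro (h | ⟨h, _⟩ | ⟨h1, h2⟩)
        · exact absurd h hHo
        · exact absurd h hq
        · exact ⟨h1, h2⟩
      · rintro ⟨h1, h2⟩; exact Or.inr (Or.inr ⟨h1, h2⟩)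
    have e4 : Conn ends (Function.update xf f true) a₁ b ↔ Conn ends xf a₁ b := by
      rw [key]; constructor
      · rintro (h | ⟨_, h⟩ | ⟨h, _⟩)
        · exact h
        · exact absurd h hvb
        · exact absurd h ha1v
      · intro h; exact Or.inl h
    have e5 : Conn ends (Function.update xf f true) a₂ b ↔ Conn ends xf a₂ v ∧ Conn ends xf a₁ b := by
      rw [key]; constructor
      · rintro (h | ⟨h, _⟩ | ⟨h1, h2⟩)
        · exact absurd h hHb
        · exact absurd h hq
        · exact ⟨h1, h2⟩
      · rintro ⟨h1, h2⟩; exact Or.inr (Or.inr ⟨h1, h2⟩)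
    have e6 : Conn ends (Function.update xf f true) a₁ a₃ ↔ Conn ends xf v a₃ := by
      rw [key]; constructor
      · rintro (h | ⟨_, h⟩ | ⟨h, _⟩)
        · exact absurd h hL3
        · exact h
        · exact absurd h ha1v
      · intro h; exact Or.inr (Or.inl ⟨conn_refl _ _ _, h⟩)
    have e7 : Conn ends (Function.update xf f true) a₂ a₃ ↔ Conn ends xf a₂ a₃ := by
      rw [key]; constructor
      · rintro (h | ⟨h, _⟩ | ⟨_, h⟩)
        · exact h
        · exact absurd h hq
        · exact absurd h hL3
      · intro h; exact Or.inl h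
    rw [decide_eq_decide.mpr e1, decide_eq_decide.mpr e2, decide_eq_decide.mpr e3,
      decide_eq_decide.mpr e4, decide_eq_decide.mpr e5, decide_eq_decide.mpr e6,
      decide_eq_decide.mpr e7]
    · simp only [Bool.decide_and]
    all_goals infer_instance

end Support

/-! ## The kernel on the support, the factorisation and the theorem -/

section Main

open Classical

variable {V : Type*} {E : Type*} [Fintype E] [DecidableEq E] {R : Type*} [Field R]
  [LinearOrder R] [IsStrictOrderedRing R]
variable (ends : E → Sym2 V) (o a₁ a₂ a₃ b v : V) (f : E)

omit [Fintype E] [DecidableEq E] [LinearOrder R] [IsStrictOrderedRing R] in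
/-- Connected vertices have the same cluster. -/
lemma cluster_eq_of_conn {ω : Config E} {u u' : V} (h : Conn ends ω u u') :
    cluster ends ω u = cluster ends ω u' := by
  ext t
  simp only [mem_cluster]
  exact ⟨fun ht => conn_trans (conn_symm h) ht, fun ht => conn_trans h ht⟩

omit [Fintype E] [LinearOrder R] [IsStrictOrderedRing R] in
/-- Restricting to a set not containing the bridge ignores the bridge bit. -/
lemma restr_update_closed {A : Finset E} (hfA : f ∉ A) (z x : Config E) :
    restr A z (Function.update x f false) = restr A z x := by
  funext e
  by_cases he : e ∈ A
  · have hef : e ≠ f := fun h => hfA (h ▸ he)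
    simp [restr, he, Function.update_of_ne hef]
  · simp [restr, he]

omit [Fintype E] [LinearOrder R] [IsStrictOrderedRing R] in
/-- Closing the bridge in the `h⁺`-restriction is the `h`-restriction of the bridge-closed copy. -/
lemma update_restr_sideH (A : Finset E) (hfA : f ∉ A) (z x : Config E) (hz : z f = false) :
    Function.update (restr (A ∪ {f}) z x) f false = restr A z (Function.update x f false) := by
  funext e
  by_cases hef : e = f
  · subst hef
    simp [restr, hfA, hz]
  · rw [Function.update_of_ne hef]
    by_cases he : e ∈ A
    · simp [restr, he, Function.update_of_ne hef]
    · simp [restr, he, hef]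

/-- The `h⁺`-kernel of a coefficient `H`: `H` at the bridge bits and `h`-states of the copies. -/
noncomputable def hK (H : Bool → HState → Bool → HState → Bool → HState → ℤ) :
    Config E → Config E → Config E → R :=
  fun x y w => ((H (x f) (hst ends a₂ a₃ v f x) (y f) (hst ends a₂ a₃ v f y) (w f)
    (hst ends a₂ a₃ v f w) : ℤ) : R)

/-- `l`-kernel of `L_b(w) L_o(w)`. -/
noncomputable def lK1 : Config E → Config E → Config E → R :=
  fun _ _ w => iL ends a₁ b w * iL ends a₁ o w
/-- `l`-kernel of `L_b(w) L_o(y)`. -/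
noncomputable def lK2 : Config E → Config E → Config E → R :=
  fun _ y w => iL ends a₁ b w * iL ends a₁ o y
/-- `l`-kernel of `L_o(w) L_b(y)`. -/
noncomputable def lK3 : Config E → Config E → Config E → R :=
  fun _ y w => iL ends a₁ o w * iL ends a₁ b y
/-- `l`-kernel of `L_o(x) L_b(y)`. -/
noncomputable def lK4 : Config E → Config E → Config E → R :=
  fun x y _ => iL ends a₁ o x * iL ends a₁ b y

omit [Fintype E] [LinearOrder R] [IsStrictOrderedRing R] in
/-- The `h`-state of a copy of the support is that of its `h⁺`-restriction. -/
lemma hst_restr {F : Finset E} {z : Config E} (hzf : z f = false) (hf : f ∈ F)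
    (hv : v ∈ cluster ends (zF (F.erase f) z) a₂) {x : Config E} (hx : ∀ e, e ∉ F → x e = z e) :
    hst ends a₂ a₃ v f (restr (FL ends a₂ (F.erase f) z ∪ {f}) z x) = hst ends a₂ a₃ v f x := by
  have hfH : f ∉ FL ends a₂ (F.erase f) z := fun h =>
    (Finset.mem_erase.1 (FL_subset ends a₂ (F.erase f) z h)).1 rfl
  have hzz : Function.update z f false = z := Function.update_eq_self_iff.2 hzf.symm
  have hx' : ∀ e, e ∉ F.erase f → Function.update x f false e = z e := by
    have := closed_on_support f hx hf
    rwa [hzz] at this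
  have hFLv : FL ends v (F.erase f) z = FL ends a₂ (F.erase f) z := by
    unfold FL
    rw [cluster_eq_of_conn ends (conn_symm (mem_cluster.1 hv))]
  have e1 : ∀ t, Conn ends (Function.update (restr (FL ends a₂ (F.erase f) z ∪ {f}) z x) f false) a₂ t ↔
      Conn ends (Function.update x f false) a₂ t := by
    intro t
    rw [update_restr_sideH f _ hfH z x hzf]
    exact (conn_restr_iff ends a₂ (F.erase f) z hx' t).symm
  have e2 : ∀ t, Conn ends (Function.update (restr (FL ends a₂ (F.erase f) z ∪ {f}) z x) f false) v t ↔
      Conn ends (Function.update x f false) v t := by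
    intro t
    rw [update_restr_sideH f _ hfH z x hzf, ← hFLv]
    exact (conn_restr_iff ends v (F.erase f) z hx' t).symm
  unfold hst
  simp only [e1, e2]

omit [Fintype E] [LinearOrder R] [IsStrictOrderedRing R] in
/-- **`K₃` on the support of a root-bridge instance** is the four-monomial expansion, each monomial
an `l`-kernel of the `l`-restriction times an `h⁺`-kernel of the `h⁺`-restriction. -/
theorem K3_eq_bridge {F : Finset E} {z : Config E} (τ : E → ℕ) (hτf : τ f = 1 ∨ τ f = 2)
    (hzf : z f = false) (hf : f ∈ F) (hends : ends f = s(a₁, v))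
    (hsep : Sep ends a₁ a₂ (F.erase f) z) (hv : v ∈ cluster ends (zF (F.erase f) z) a₂)
    (ho : o ∈ cluster ends (zF (F.erase f) z) a₁) (hb : b ∈ cluster ends (zF (F.erase f) z) a₁)
    (h3 : a₃ ∈ cluster ends (zF (F.erase f) z) a₂)
    {x y w : Config E} (hx : ∀ e, e ∉ F → x e = z e) (hy : ∀ e, e ∉ F → y e = z e)
    (hw : ∀ e, e ∉ F → w e = z e) (hopen : openCount x y w f = τ f) :
    (K3 ends o a₁ a₂ a₃ b x y w : R) =
      lK1 ends o a₁ b (restr (FL ends a₁ (F.erase f) z) z x) (restr (FL ends a₁ (F.erase f) z) z y)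
          (restr (FL ends a₁ (F.erase f) z) z w) *
        hK ends a₂ a₃ v f H1 (restr (FL ends a₂ (F.erase f) z ∪ {f}) z x)
          (restr (FL ends a₂ (F.erase f) z ∪ {f}) z y) (restr (FL ends a₂ (F.erase f) z ∪ {f}) z w) +
      lK2 ends o a₁ b (restr (FL ends a₁ (F.erase f) z) z x) (restr (FL ends a₁ (F.erase f) z) z y)
          (restr (FL ends a₁ (F.erase f) z) z w) *
        hK ends a₂ a₃ v f H2 (restr (FL ends a₂ (F.erase f) z ∪ {f}) z x)
          (restr (FL ends a₂ (F.erase f) z ∪ {f}) z y) (restr (FL ends a₂ (F.erase f) z ∪ {f}) z w) +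
      lK3 ends o a₁ b (restr (FL ends a₁ (F.erase f) z) z x) (restr (FL ends a₁ (F.erase f) z) z y)
          (restr (FL ends a₁ (F.erase f) z) z w) *
        hK ends a₂ a₃ v f H3 (restr (FL ends a₂ (F.erase f) z ∪ {f}) z x)
          (restr (FL ends a₂ (F.erase f) z ∪ {f}) z y) (restr (FL ends a₂ (F.erase f) z ∪ {f}) z w) +
      lK4 ends o a₁ b (restr (FL ends a₁ (F.erase f) z) z x) (restr (FL ends a₁ (F.erase f) z) z y)
          (restr (FL ends a₁ (F.erase f) z) z w) *
        hK ends a₂ a₃ v f H4 (restr (FL ends a₂ (F.erase f) z ∪ {f}) z x)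
          (restr (FL ends a₂ (F.erase f) z ∪ {f}) z y) (restr (FL ends a₂ (F.erase f) z ∪ {f}) z w) := by
  have hzz : Function.update z f false = z := Function.update_eq_self_iff.2 hzf.symm
  have hfL : f ∉ FL ends a₁ (F.erase f) z := fun h =>
    (Finset.mem_erase.1 (FL_subset ends a₁ (F.erase f) z h)).1 rfl
  have hadm : Adm (x f) (y f) (w f) := by
    unfold Adm; unfold openCount at hopen; omega
  -- the states of the three copies
  have hst3 : ∀ {u : Config E}, (∀ e, e ∉ F → u e = z e) →
      st ends o a₁ a₂ a₃ b u = brSt (u f) (hst ends a₂ a₃ v f u)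
        (decide (Conn ends (Function.update u f false) a₁ o))
        (decide (Conn ends (Function.update u f false) a₁ b)) := by
    intro u hu
    exact st_eq_brSt ends o a₁ a₂ a₃ b v f hzf hf hends hsep hv ho hb h3 hu
  -- the `l`-coordinates through the `l`-restriction
  have hL : ∀ {u : Config E}, (∀ e, e ∉ F → u e = z e) → ∀ m : V,
      ((decide (Conn ends (Function.update u f false) a₁ m)).toNat : R) =
        iL ends a₁ m (restr (FL ends a₁ (F.erase f) z) z u) := by
    intro u hu m
    have hu' : ∀ e, e ∉ F.erase f → Function.update u f false e = z e := by
      have := closed_on_support f hu hf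
      rwa [hzz] at this
    rw [toNat_decide_conn_a1 ends a₁ m (F.erase f) z hu', restr_update_closed f hfL]
  -- the bridge bit through the `h⁺`-restriction
  have hfB : ∀ u : Config E, (restr (FL ends a₂ (F.erase f) z ∪ {f}) z u) f = u f := fun u =>
    restr_of_mem (Finset.mem_union_right _ (Finset.mem_singleton_self f))
  rw [K3_eq_KB, hst3 hx, hst3 hy, hst3 hw, KB_brSt _ _ _ _ _ _ _ _ _ _ _ _ hadm]
  unfold expansion hK lK1 lK2 lK3 lK4
  rw [hst_restr ends a₂ a₃ v f hzf hf hv hx, hst_restr ends a₂ a₃ v f hzf hf hv hy,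
    hst_restr ends a₂ a₃ v f hzf hf hv hw, hfB, hfB, hfB]
  push_cast
  simp only [hL hx, hL hy, hL hw]

end Main

end RootBridge

end CovForm

end Summit.Ventures.PercRepro2

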